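import Mathlib
import HarnessLib
import Summits.HubbardSuperconductivity.HubbardSuperconductivity.Theorems.KLProgrammeKLRegimeEngineV8IsoMomentRowClosers
import Summits.HubbardSuperconductivity.HubbardSuperconductivity.Theorems.KLProgrammeKLRegimeEngineIsoTupleSmallnessV2
import Summits.HubbardSuperconductivity.HubbardSuperconductivity.Theorems.KLProgrammeKLRegimeEngineBareBallDiagonalPoint
import Summits.HubbardSuperconductivity.HubbardSuperconductivity.Theorems.KLProgrammeKLRegimeEngineV8DefsQ9c

/-!
# Route `KLProgramme` — ENGINE child gen 8 (stmt-HubbardSuperconductivity-20437 `KLRegimeEngineV17F2`), class #6 under «G10-MOM» (rev 11):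
# (E5-F)ₙ input (III) RE-KEYED AT THE G TOKEN (`klEngGeo10`, whose `CF` carries `2¹⁸·klIsoMomC`) and THE STUB-(c) (E5-F)ₙ CLOSER
# at the rev-11 tokens MODULO (c)'s own (E2″-F)ₙ (cell gate-hubbard-kl, seat hubbard-kl-k3c2-p2 g14)

WHY.  The accumulated-rows smallness (III) of the (E5-F)ₙ door reads `G.CF` (`16/3·CF·Klam²` in `klE5RowsD G P Q`); the landed U-door entry
`klE5RowsU P R` (DefsU10 entry 7) is keyed at `(klEngGeo8, klEngQ8 P R)` and cannot serve a package whose `CF` is larger — in particular not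
`klEngGeo10` (`CF = klEngGeo8.CF + 7·2⁵² + 2¹⁸·klIsoMomC`, the last summand opaque).  This file re-keys the entry G/Q-GENERICALLY and assembles the
stub-(c) closer of conjunct 4 at rev 11's tokens.
* §1 **`klE5RowsUG G P Q := 1/(4·max 1 (klE5RowsD G P Q))`** (any package), `_pos`, `mul_klE5RowsD_le_quarter_of_le_klE5RowsUG`;
* §2 **`rowsSmallness_of_le_klE5RowsUG`**: at any well-formed `G` and any raise `Q` of `klEngQ8 P R`, under `0 < U ≤ klEngU₀10 P R c`, `U ≤ klE5RowsUG G P Q`,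
  `n ≤ n_β + 1`, `klEngL₄ P R β U ≤ L`: the rows-smallness line (input (III)) — `rowsSmallness_of_doors` with both door lines discharged;
* §3 the rev-11 token entry **`klE5RowsU10 P R := klE5RowsUG klEngGeo10 P (klEngQ9c P R)`** (DefsU12 `min` entry; `_pos`, `_eq`) and `rowsSmallness_klEng10Q9c`;
* §4 **`isoTupleL1AtV17F_klEng10_of_hiso`** — STUB (c) CONJUNCT 4 at `(klEngGeo10, klEngQ9c P R)` from: the `hiso` binder at `j = n`, the history, the
  CURRENT (E2″-F)ₙ (conjunct 2 of (c), proved first), and the three U-door rows `U ≤ klEngU₀10 P R c`, `U ≤ klE5uM P R`, `U ≤ klE5RowsU10 P R`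
  (the two bare-ball points are `exists_mem_klBall_zero_diag_of_klEngL₃_le`'s diagonal point; `R.Gfr 0·|U| ≤ klE0/32` is `gfr0_mul_abs_le_of_le_klEngU₀10`).
Inequalities between landed predicates; nothing about the model is asserted; nothing asserts superconductivity.
-/

noncomputable section

namespace Summit.HubbardSuperconductivity.HubbardSuperconductivity.Theorems.KLRegimeSplit

set_option linter.dupNamespace false -- summit = problem name (single-conjunct summit), D-0017

open Real Finset Literature.MathematicalPhysics.QuantumLattice Literature.Probability.LatticeModels
open Summit.HubbardSuperconductivity.HubbardSuperconductivity.Theorems.KLProgrammeLegKernels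
open Summit.HubbardSuperconductivity.HubbardSuperconductivity.Theorems.DispersionFlow
open Summit.HubbardSuperconductivity.HubbardSuperconductivity.Theorems.EngineV8

/-! ## §1 The G/Q-generic rows U-door -/

/-- **`klE5RowsUG G P Q := 1/(4·max 1 (klE5RowsD G P Q))`** — the accumulated-rows U-door at ANY package (DefsU10's `klE5RowsU P R` is the instance
`(klEngGeo8, klEngQ8 P R)`). -/
def klE5RowsUG (G : GeoConsts) (P : SplitConsts) (Q : EngConsts) : ℝ := 1 / (4 * max 1 (klE5RowsD G P Q))

/-- `0 < klE5RowsUG G P Q` (unconditionally, by the `max 1` guard). -/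
theorem klE5RowsUG_pos (G : GeoConsts) (P : SplitConsts) (Q : EngConsts) : 0 < klE5RowsUG G P Q := by
  unfold klE5RowsUG
  have : (0 : ℝ) < max 1 (klE5RowsD G P Q) := lt_of_lt_of_le one_pos (le_max_left _ _)
  positivity

/-- `klE5RowsU P R = klE5RowsUG klEngGeo8 P (klEngQ8 P R)` (DefsU10's entry is the v2 instance). -/
theorem klE5RowsU_eq_klE5RowsUG (P : SplitConsts) (R : RenConsts) : klE5RowsU P R = klE5RowsUG klEngGeo8 P (klEngQ8 P R) := rfl

/-- **The entry's consumer line**: `0 ≤ U ≤ klE5RowsUG G P Q ⟹ U·klE5RowsD G P Q ≤ 1/4`. -/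
theorem mul_klE5RowsD_le_quarter_of_le_klE5RowsUG {G : GeoConsts} {P : SplitConsts} {Q : EngConsts} {U : ℝ} (hU : 0 ≤ U)
    (h : U ≤ klE5RowsUG G P Q) : U * klE5RowsD G P Q ≤ 1 / 4 := by
  have hm1 : (1 : ℝ) ≤ max 1 (klE5RowsD G P Q) := le_max_left _ _
  have hm0 : (0 : ℝ) < max 1 (klE5RowsD G P Q) := lt_of_lt_of_le one_pos hm1
  have hDm : klE5RowsD G P Q ≤ max 1 (klE5RowsD G P Q) := le_max_right _ _
  have h1 : U * klE5RowsD G P Q ≤ U * max 1 (klE5RowsD G P Q) := mul_le_mul_of_nonneg_left hDm hU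
  have h2 : U * max 1 (klE5RowsD G P Q) ≤ 1 / (4 * max 1 (klE5RowsD G P Q)) * max 1 (klE5RowsD G P Q) :=
    mul_le_mul_of_nonneg_right h hm0.le
  have h3 : 1 / (4 * max 1 (klE5RowsD G P Q)) * max 1 (klE5RowsD G P Q) = 1 / 4 := by
    field_simp
  linarith [h3.le, h3.ge]

/-! ## §2 Input (III) at any package and any raise of `klEngQ8 P R` -/

/-- **(E5-F)ₙ input (III) at ANY well-formed `G` and any raise `Q` of `klEngQ8 P R`** (`Q.CL = (klEngQ8 P R).CL`): under `0 < U ≤ klEngU₀10 P R c`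
(for `U ≤ 1`), `U ≤ klE5RowsUG G P Q`, `n ≤ n_β + 1`, `klEngL₄ P R β U ≤ L`, the rows-smallness line at `(G, P, Q)`. -/
theorem rowsSmallness_of_le_klE5RowsUG {G : GeoConsts} (hG : G.WF) (P : SplitConsts) (R : RenConsts) (hP : P.WF) {Q : EngConsts}
    (hQ : (klEngQ8 P R).IsRaiseOf Q) {c β U : ℝ} (hβ : klBetaMin ≤ β) (hU : 0 < U) (hU10 : U ≤ klEngU₀10 P R c) (hUG : U ≤ klE5RowsUG G P Q)
    {n L : ℕ} (hn : n ≤ nScales β + 1) (hL : klEngL₄ P R β U ≤ L) :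
    initDevBar G U + legDressBarQ2 G P Q U 0 4 +
        (3 * G.CF * (P.Klam * U) ^ 2 +
          ((G.cloc * P.Klam ^ 2 * (1 - (4 : ℝ) ^ (-G.θ))⁻¹ + 2 * Q.CR * P.Klam ^ 3 * |U|) * U ^ 2 + ∑ j ∈ range n, Q.CL β j / L) +
            7 / 3 * (G.CF * (P.Klam * U) ^ 2) + 20 * (Q.CR * ((P.Klam * U) ^ 2 + (P.Klam * |U|) ^ 3)) +
              4 / 3 * (Q.CR * (P.Klam * U) ^ 2)) ≤ U / 2 := by
  have hD : U * ((∑ χ, (G.abot χ + G.atop χ) + 1) + 24 * Q.CR * (P.Klam ^ 2 + P.Klam ^ 3) + 16 / 3 * G.CF * P.Klam ^ 2 +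
      G.cloc * P.Klam ^ 2 * (1 - (4 : ℝ) ^ (-G.θ))⁻¹ + 2 * Q.CR * P.Klam ^ 3 + 4 / 3 * Q.CR * P.Klam ^ 2) ≤ 1 / 4 := by
    have h := mul_klE5RowsD_le_quarter_of_le_klE5RowsUG hU.le hUG
    rw [klE5RowsD_eq] at h
    exact h
  exact rowsSmallness_of_doors hG hP (hQ.wf (klEngQ8_wf P R)) hU (le_one_of_le_klEngU₀3 (hU10.trans (klEngU₀10_le_klEngU₀3 P R c))) hD
    (sum_CL_div_le_of_isRaiseOf_klEngQ8 P R hQ hβ hU hn hL)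

/-! ## §3 The rev-11 token entry -/

/-- **`klE5RowsU10 P R := klE5RowsUG klEngGeo10 P (klEngQ9c P R)`** — DefsU12's accumulated-rows entry at the rev-11 keys `(klEngGeo10, klEngQ9c P R)`. -/
def klE5RowsU10 (P : SplitConsts) (R : RenConsts) : ℝ := klE5RowsUG klEngGeo10 P (klEngQ9c P R)

/-- `klE5RowsU10 P R = klE5RowsUG klEngGeo10 P (klEngQ9c P R)` (`rfl`). -/
theorem klE5RowsU10_eq (P : SplitConsts) (R : RenConsts) : klE5RowsU10 P R = klE5RowsUG klEngGeo10 P (klEngQ9c P R) := rfl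

/-- `0 < klE5RowsU10 P R`. -/
theorem klE5RowsU10_pos (P : SplitConsts) (R : RenConsts) : 0 < klE5RowsU10 P R := klE5RowsUG_pos _ _ _

/-- **Input (III) at the rev-11 keys** `(klEngGeo10, klEngQ9c P R)`: `0 < U ≤ klEngU₀10 P R c`, `U ≤ klE5RowsU10 P R`, `n ≤ n_β + 1`, `klEngL₄ P R β U ≤ L`. -/
theorem rowsSmallness_klEng10Q9c (P : SplitConsts) (R : RenConsts) (hP : P.WF) {c β U : ℝ} (hβ : klBetaMin ≤ β) (hU : 0 < U)
    (hU10 : U ≤ klEngU₀10 P R c) (hUR : U ≤ klE5RowsU10 P R) {n L : ℕ} (hn : n ≤ nScales β + 1) (hL : klEngL₄ P R β U ≤ L) :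
    initDevBar klEngGeo10 U + legDressBarQ2 klEngGeo10 P (klEngQ9c P R) U 0 4 +
        (3 * klEngGeo10.CF * (P.Klam * U) ^ 2 +
          ((klEngGeo10.cloc * P.Klam ^ 2 * (1 - (4 : ℝ) ^ (-klEngGeo10.θ))⁻¹ + 2 * (klEngQ9c P R).CR * P.Klam ^ 3 * |U|) * U ^ 2 +
              ∑ j ∈ range n, (klEngQ9c P R).CL β j / L) +
            7 / 3 * (klEngGeo10.CF * (P.Klam * U) ^ 2) + 20 * ((klEngQ9c P R).CR * ((P.Klam * U) ^ 2 + (P.Klam * |U|) ^ 3)) +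
              4 / 3 * ((klEngQ9c P R).CR * (P.Klam * U) ^ 2)) ≤ U / 2 :=
  rowsSmallness_of_le_klE5RowsUG klEngGeo10_wf P R hP (isRaiseOf_klEngQ9c_klEngQ8 P R) hβ hU hU10 hUR hn hL

/-! ## §4 Stub (c) conjunct 4 — (E5-F)ₙ at the rev-11 tokens, modulo (c)'s own (E2″-F)ₙ -/

section Closer

variable {L M : ℕ} [NeZero L] [NeZero M]

/-- **STUB (c) CONJUNCT 4 at `(klEngGeo10, klEngQ9c P R)`** (`1 ≤ n ≤ n_β + 1`): the class-#6 `hiso` binder at `j = n`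
(`IsoTupleLineBAt L M klE5AM klE5cM (klE5dM P R) P β U μ n`), the history, the CURRENT (E2″-F)ₙ (`PairValueIncrementAtV17F … n`, (c)'s conjunct 2), and the
U-door rows `U ≤ klEngU₀10 P R c` (⇒ `U ≤ 1`, `R.Gfr 0·|U| ≤ klE0/32`), `U ≤ klE5uM P R` (the class-#6 fit at `klEngGeo10`), `U ≤ klE5RowsU10 P R` (input (III)),
with `klEngL₄ P R β U ≤ L` ⟹ `IsoTupleL1AtV17F L M klEngGeo10 P β U μ n`.  The two bare-ball points are the diagonal point of `…BareBallDiagonalPoint`. -/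
theorem isoTupleL1AtV17F_klEng10_of_hiso (P : SplitConsts) (R : RenConsts) (hP : P.WF) (hR : R.WF2) {c μ U β : ℝ} (hμ : μ ∈ klWindowC)
    (hU : 0 < U) (hU10 : U ≤ klEngU₀10 P R c) (hUM : U ≤ klE5uM P R) (hUR : U ≤ klE5RowsU10 P R) (hβ : klBetaMin ≤ β)
    (hL : klEngL₄ P R β U ≤ L) {n : ℕ} (hn1 : 1 ≤ n) (hn : n ≤ nScales β + 1)
    (hline : IsoTupleLineBAt L M klE5AM klE5cM (klE5dM P R) P β U μ n)
    (hhist : HistP klPredsV17F2 L M klEngGeo10 P (klEngQ9c P R) R β U μ 0 n)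
    (hE2'' : PairValueIncrementAtV17F L M klEngGeo10 P (klEngQ9c P R) β U μ n) :
    IsoTupleL1AtV17F L M klEngGeo10 P β U μ n := by
  obtain ⟨q, hq, hqq⟩ := exists_mem_klBall_zero_diag_of_klEngL₃_le (L := L) hμ hβ (klEngL₃_le_of_klEngL₄_le hL)
  have hUκ : R.Gfr 0 * |U| ≤ 1 / 32 * klE0 := (gfr0_mul_abs_le_of_le_klEngU₀10 hU hU10).trans_eq (by ring)
  exact isoTupleL1AtV17F_klEngGeo10_of_klE5M_hist hP ((isRaiseOf_klEngQ9c_klEngQ8 P R).wf (klEngQ8_wf P R)) hR hU hn1 hn hUM hline hhist hE2''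
    hq hq hqq hUκ (rowsSmallness_klEng10Q9c P R hP hβ hU hU10 hUR hn hL)

end Closer

end Summit.HubbardSuperconductivity.HubbardSuperconductivity.Theorems.KLRegimeSplit

end
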